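import Summits.CriticalPhenomena.CardyFormulaZ2.Theorems.CardyBoundaryCoulombGasStripClusterRatesRectBoxMesh
import Literature.Probability.RandomPlanarGeometry.PlanarDomains
import HarnessLib

/-!
# `stub_z2BoxesToRectCardy`, part 1: the side arcs of the corner-marked rectangle `(0,w)×(0,h)`

Support file for line `birth` of crux `BoxFamilyToCardy` (stmt-CriticalPhenomena-14215), stub
`stub_z2BoxesToRectCardy` (boxes → Smirnov's discretised rectangles). This part is pure plane
topology and proves the statement of the sibling line's `RectValue … stub_sideArcs`
(`Cruxes/RectValue/Lines/birth.lean`) as the theorem `rect_sideArcs`: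

for EVERY conformal rectangle `R` (any boundary parametrisation) whose carrier is the open box
`(0,w)×(0,h)` and whose marked points are the corners `pt 0 = ih`, `pt 1 = 0`, `pt 2 = w`,
`pt 3 = w + ih`, the arc `R.arc 0` (from `pt 0` to `pt 1`) is the closed LEFT side
`{re = 0, 0 ≤ im ≤ h}` and `R.arc 2` (from `pt 2` to `pt 3`) is the closed RIGHT side
`{re = w, 0 ≤ im ≤ h}`.

Proof (Jordan-arc bookkeeping, no Jordan curve theorem): the open arc
`boundary '' Ioo (mark j) (mark (j+1))` is a connected subset of the perimeter missing the four
corners (injectivity of the boundary loop on one period); the perimeter minus its corners is covered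
by the four pairwise disjoint OPEN "closest side" regions
`{re < im, re < h − im, re < w − re}` (left), … , whose traces on the perimeter are the four open
sides, so a connected piece lies on one side line (`subset_line_of_isPreconnected`); the closed arc
lies in the closure, and the two end corners rule out three of the four lines; finally a connected
subset of a vertical segment containing both endpoints is the whole segment. No definitions are
introduced.

References: S. Smirnov, C. R. Acad. Sci. Paris 333 (2001) 239, §2 [Smirnov2001];
W. Werner, *Lectures on two-dimensional critical percolation* (2007), §3 [Werner2007].
-/

noncomputable section

namespace Summit.CriticalPhenomena.CardyFormulaZ2.Cruxes.BoxFamilyToCardy.Birth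

open Set Complex
open Literature.Probability.RandomPlanarGeometry
open Summit.CriticalPhenomena.CardyFormulaZ2.Cruxes.StripClusterRates.TwoClusterRateIsStationaryGap
  (RectBox.mem_frontier_obox)

namespace RectSides

variable {w h : ℝ}

/-! ## The perimeter of the box minus its corners: four connected pieces -/

/-- **A connected piece of the perimeter of `(0,w)×(0,h)` missing the four corners lies on one side
line.** The four open "closest side" regions are pairwise disjoint, cover the perimeter minus the
corners, and meet the perimeter in the four open sides. [folklore] -/
theorem subset_line_of_isPreconnected (hw : 0 < w) (hh : 0 < h) {C : Set ℂ} (hC : IsPreconnected C)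
    (hCP : C ⊆ frontier (Ioo (0 : ℝ) w ×ℂ Ioo (0 : ℝ) h) \
      {(h : ℂ) * I, 0, (w : ℂ), (w : ℂ) + (h : ℂ) * I}) :
    C ⊆ {z : ℂ | z.re = 0} ∨ C ⊆ {z : ℂ | z.im = 0} ∨ C ⊆ {z : ℂ | z.re = w} ∨ C ⊆ {z : ℂ | z.im = h} := by
  -- the four open "closest side" regions
  set UL : Set ℂ := {z : ℂ | z.re < z.im} ∩ ({z : ℂ | z.re < h - z.im} ∩ {z : ℂ | z.re < w - z.re})
    with hUL
  set UB : Set ℂ := {z : ℂ | z.im < z.re} ∩ ({z : ℂ | z.im < w - z.re} ∩ {z : ℂ | z.im < h - z.im})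
    with hUB
  set UR : Set ℂ := {z : ℂ | w - z.re < z.im} ∩ ({z : ℂ | w - z.re < h - z.im} ∩ {z : ℂ | w - z.re < z.re})
    with hUR
  set UT : Set ℂ := {z : ℂ | h - z.im < z.re} ∩ ({z : ℂ | h - z.im < w - z.re} ∩ {z : ℂ | h - z.im < z.im})
    with hUT
  have oL : IsOpen UL :=
    (isOpen_lt continuous_re continuous_im).inter
      ((isOpen_lt continuous_re (continuous_const.sub continuous_im)).inter
        (isOpen_lt continuous_re (continuous_const.sub continuous_re)))
  have oB : IsOpen UB :=
    (isOpen_lt continuous_im continuous_re).inter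
      ((isOpen_lt continuous_im (continuous_const.sub continuous_re)).inter
        (isOpen_lt continuous_im (continuous_const.sub continuous_im)))
  have oR : IsOpen UR :=
    (isOpen_lt (continuous_const.sub continuous_re) continuous_im).inter
      ((isOpen_lt (continuous_const.sub continuous_re) (continuous_const.sub continuous_im)).inter
        (isOpen_lt (continuous_const.sub continuous_re) continuous_re))
  have oT : IsOpen UT :=
    (isOpen_lt (continuous_const.sub continuous_im) continuous_re).inter
      ((isOpen_lt (continuous_const.sub continuous_im) (continuous_const.sub continuous_re)).inter
        (isOpen_lt (continuous_const.sub continuous_im) continuous_im))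
  -- pairwise disjointness
  have dRT : Disjoint UR UT := by
    rw [Set.disjoint_left]
    rintro z ⟨-, h1, -⟩ ⟨-, h2, -⟩
    simp only [mem_setOf_eq] at h1 h2
    linarith
  have dB : Disjoint UB (UR ∪ UT) := by
    rw [Set.disjoint_left]
    rintro z ⟨-, h1, h2⟩ (⟨h3, -, -⟩ | ⟨-, -, h3⟩)
    · simp only [mem_setOf_eq] at h1 h3; linarith
    · simp only [mem_setOf_eq] at h2 h3; linarith
  have dL : Disjoint UL (UB ∪ (UR ∪ UT)) := by
    rw [Set.disjoint_left]
    rintro z ⟨h1, h2, h3⟩ (⟨h4, -, -⟩ | ⟨-, -, h4⟩ | ⟨h4, -, -⟩)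
    · simp only [mem_setOf_eq] at h1 h4; linarith
    · simp only [mem_setOf_eq] at h3 h4; linarith
    · simp only [mem_setOf_eq] at h2 h4; linarith
  -- the perimeter minus the corners is covered by the four regions
  have cover : C ⊆ UL ∪ (UB ∪ (UR ∪ UT)) := by
    intro z hz
    obtain ⟨hzP, hzc⟩ := hCP hz
    simp only [mem_insert_iff, mem_singleton_iff, not_or] at hzc
    obtain ⟨hc0, hc1, hc2, hc3⟩ := hzc
    rcases (RectBox.mem_frontier_obox hw hh).1 hzP with ⟨⟨hr0, hrw⟩, him | him⟩ | ⟨hre | hre, hi0, hih⟩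
    · -- bottom side: `im = 0`, corners `0` and `w` excluded
      have hre0 : z.re ≠ 0 := fun hre => hc1 (Complex.ext (by simp [hre]) (by simp [him]))
      have hrew : z.re ≠ w := fun hre => hc2 (Complex.ext (by simp [hre]) (by simp [him]))
      have h1 : 0 < z.re := lt_of_le_of_ne hr0 (Ne.symm hre0)
      have h2 : z.re < w := lt_of_le_of_ne hrw hrew
      refine Or.inr (Or.inl ⟨?_, ?_, ?_⟩) <;> simp only [mem_setOf_eq] <;> linarith
    · -- top side: `im = h`, corners `ih` and `w + ih` excluded
      have hre0 : z.re ≠ 0 := fun hre => hc0 (Complex.ext (by simp [hre]) (by simp [him]))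
      have hrew : z.re ≠ w := fun hre => hc3 (Complex.ext (by simp [hre]) (by simp [him]))
      have h1 : 0 < z.re := lt_of_le_of_ne hr0 (Ne.symm hre0)
      have h2 : z.re < w := lt_of_le_of_ne hrw hrew
      refine Or.inr (Or.inr (Or.inr ⟨?_, ?_, ?_⟩)) <;> simp only [mem_setOf_eq] <;> linarith
    · -- left side: `re = 0`, corners `0` and `ih` excluded
      have him0 : z.im ≠ 0 := fun him => hc1 (Complex.ext (by simp [hre]) (by simp [him]))
      have himh : z.im ≠ h := fun him => hc0 (Complex.ext (by simp [hre]) (by simp [him]))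
      have h1 : 0 < z.im := lt_of_le_of_ne hi0 (Ne.symm him0)
      have h2 : z.im < h := lt_of_le_of_ne hih himh
      refine Or.inl ⟨?_, ?_, ?_⟩ <;> simp only [mem_setOf_eq] <;> linarith
    · -- right side: `re = w`, corners `w` and `w + ih` excluded
      have him0 : z.im ≠ 0 := fun him => hc2 (Complex.ext (by simp [hre]) (by simp [him]))
      have himh : z.im ≠ h := fun him => hc3 (Complex.ext (by simp [hre]) (by simp [him]))
      have h1 : 0 < z.im := lt_of_le_of_ne hi0 (Ne.symm him0)
      have h2 : z.im < h := lt_of_le_of_ne hih himh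
      refine Or.inr (Or.inr (Or.inl ⟨?_, ?_, ?_⟩)) <;> simp only [mem_setOf_eq] <;> linarith
  -- traces of the four regions on the perimeter
  have trace : ∀ z ∈ C, (z ∈ UL → z.re = 0) ∧ (z ∈ UB → z.im = 0) ∧ (z ∈ UR → z.re = w) ∧
      (z ∈ UT → z.im = h) := by
    intro z hz
    have hzP := (hCP hz).1
    rcases (RectBox.mem_frontier_obox hw hh).1 hzP with ⟨⟨hr0, hrw⟩, him | him⟩ | ⟨hre | hre, hi0, hih⟩
    · refine ⟨fun hU => ?_, fun _ => him, fun hU => ?_, fun hU => ?_⟩ <;>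
        obtain ⟨h1, h2, h3⟩ := hU <;> simp only [mem_setOf_eq] at h1 h2 h3 <;> linarith
    · refine ⟨fun hU => ?_, fun hU => ?_, fun hU => ?_, fun _ => him⟩ <;>
        obtain ⟨h1, h2, h3⟩ := hU <;> simp only [mem_setOf_eq] at h1 h2 h3 <;> linarith
    · refine ⟨fun _ => hre, fun hU => ?_, fun hU => ?_, fun hU => ?_⟩ <;>
        obtain ⟨h1, h2, h3⟩ := hU <;> simp only [mem_setOf_eq] at h1 h2 h3 <;> linarith
    · refine ⟨fun hU => ?_, fun hU => ?_, fun _ => hre, fun hU => ?_⟩ <;>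
        obtain ⟨h1, h2, h3⟩ := hU <;> simp only [mem_setOf_eq] at h1 h2 h3 <;> linarith
  -- a connected set inside a disjoint union of opens lies in one of them
  rcases hC.subset_or_subset oL (oB.union (oR.union oT)) dL cover with hL | hBRT
  · exact Or.inl fun z hz => (trace z hz).1 (hL hz)
  rcases hC.subset_or_subset oB (oR.union oT) dB hBRT with hB | hRT
  · exact Or.inr (Or.inl fun z hz => (trace z hz).2.1 (hB hz))
  rcases hC.subset_or_subset oR oT dRT hRT with hR' | hT
  · exact Or.inr (Or.inr (Or.inl fun z hz => (trace z hz).2.2.1 (hR' hz)))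
  · exact Or.inr (Or.inr (Or.inr fun z hz => (trace z hz).2.2.2 (hT hz)))

/-- A connected subset of a vertical line containing two of its points contains the closed segment
between them. [folklore] -/
theorem vsegment_subset_of_isPreconnected {S : Set ℂ} (hS : IsPreconnected S) {a y₁ y₂ : ℝ}
    (hSa : S ⊆ {z : ℂ | z.re = a}) {p q : ℂ} (hp : p ∈ S) (hq : q ∈ S) (hp1 : p.im = y₁)
    (hq2 : q.im = y₂) : {z : ℂ | z.re = a ∧ y₁ ≤ z.im ∧ z.im ≤ y₂} ⊆ S := by
  rintro z ⟨hzre, hz1, hz2⟩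
  have himS : IsPreconnected (Complex.im '' S) := hS.image _ continuous_im.continuousOn
  have hIcc : Icc y₁ y₂ ⊆ Complex.im '' S :=
    himS.Icc_subset ⟨p, hp, hp1⟩ ⟨q, hq, hq2⟩
  obtain ⟨z', hz'S, hz'im⟩ := hIcc ⟨hz1, hz2⟩
  have hz're : z'.re = a := hSa hz'S
  have e : z' = z := Complex.ext (by rw [hz're, hzre]) hz'im
  exact e ▸ hz'S

/-! ## The open arcs of a conformal rectangle -/

/-- The next mark after `mark j` is `mark (j+1)` when `j + 1 < 4` (no wrap-around). [folklore] -/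
theorem nextMark_eq (R : ConformalRectangle) {j : Fin 4} (hj : j.val + 1 < 4) :
    R.nextMark j = R.mark ⟨j.val + 1, hj⟩ := by
  unfold MarkedDomain.nextMark
  rw [dif_pos hj]

/-- An interior parameter of the `j`-th parameter interval is not the parameter of a marked point:
the open arc `boundary '' Ioo (mark j) (mark (j+1))` misses all four marked points (injectivity of
the boundary loop on one period). [folklore] -/
theorem boundary_ne_pt (R : ConformalRectangle) {j : Fin 4} (hj : j.val + 1 < 4) {t : ℝ}
    (ht : t ∈ Ioo (R.mark j) (R.mark ⟨j.val + 1, hj⟩)) (k : Fin 4) : R.boundary t ≠ R.pt k := by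
  intro heq
  have ht01 : t ∈ Ico (0 : ℝ) 1 :=
    ⟨(R.mark_mem j).1.trans ht.1.le, ht.2.trans (R.mark_mem _).2⟩
  have htk : t = R.mark k := R.injOn_boundary ht01 (R.mark_mem k) heq
  rw [htk] at ht
  have h1 : j < k := R.strictMono_mark.lt_iff_lt.1 ht.1
  have h2 : k < ⟨j.val + 1, hj⟩ := R.strictMono_mark.lt_iff_lt.1 ht.2
  rw [Fin.lt_def] at h1 h2
  simp only at h2
  omega

/-- The closed arc `arc j` lies in the closure of the open arc `boundary '' Ioo (mark j) (mark (j+1))`.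
[folklore] -/
theorem arc_subset_closure (R : ConformalRectangle) {j : Fin 4} (hj : j.val + 1 < 4) :
    R.arc j ⊆ closure (R.boundary '' Ioo (R.mark j) (R.mark ⟨j.val + 1, hj⟩)) := by
  have hlt : R.mark j < R.mark ⟨j.val + 1, hj⟩ :=
    R.strictMono_mark (Fin.lt_def.2 (by simp))
  show R.boundary '' Icc (R.mark j) (R.nextMark j) ⊆ _
  rw [nextMark_eq R hj, ← closure_Ioo hlt.ne]
  exact image_closure_subset_closure_image R.continuous_boundary

/-- The open arc is a connected subset of the frontier missing the four marked points. [folklore] -/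
theorem image_Ioo_subset (R : ConformalRectangle) {j : Fin 4} (hj : j.val + 1 < 4) :
    R.boundary '' Ioo (R.mark j) (R.mark ⟨j.val + 1, hj⟩) ⊆
      frontier R.carrier \ {R.pt 0, R.pt 1, R.pt 2, R.pt 3} := by
  rintro _ ⟨t, ht, rfl⟩
  refine ⟨R.boundary_mem_frontier t, ?_⟩
  simp only [mem_insert_iff, mem_singleton_iff, not_or]
  exact ⟨boundary_ne_pt R hj ht 0, boundary_ne_pt R hj ht 1, boundary_ne_pt R hj ht 2,
    boundary_ne_pt R hj ht 3⟩

/-- **An arc of a corner-marked box lies on one side line**: for `R` with carrier `(0,w)×(0,h)` and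
the corners as marked points, each arc `arc j` (`j + 1 < 4`) lies on one of the four side lines.
[folklore] -/
theorem arc_subset_line (R : ConformalRectangle) (hw : 0 < w) (hh : 0 < h)
    (hcar : R.carrier = Ioo (0 : ℝ) w ×ℂ Ioo (0 : ℝ) h)
    (hpt : R.pt 0 = (h : ℂ) * I ∧ R.pt 1 = 0 ∧ R.pt 2 = (w : ℂ) ∧ R.pt 3 = (w : ℂ) + (h : ℂ) * I)
    {j : Fin 4} (hj : j.val + 1 < 4) :
    R.arc j ⊆ {z : ℂ | z.re = 0} ∨ R.arc j ⊆ {z : ℂ | z.im = 0} ∨ R.arc j ⊆ {z : ℂ | z.re = w} ∨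
      R.arc j ⊆ {z : ℂ | z.im = h} := by
  set C := R.boundary '' Ioo (R.mark j) (R.mark ⟨j.val + 1, hj⟩) with hCdef
  have hC : IsPreconnected C := isPreconnected_Ioo.image _ R.continuous_boundary.continuousOn
  have hCP : C ⊆ frontier (Ioo (0 : ℝ) w ×ℂ Ioo (0 : ℝ) h) \ {(h : ℂ) * I, 0, (w : ℂ), (w : ℂ) + (h : ℂ) * I} := by
    have h' := image_Ioo_subset R hj
    rw [hcar, hpt.1, hpt.2.1, hpt.2.2.1, hpt.2.2.2] at h'
    exact h'
  have hcl := arc_subset_closure R hj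
  have key := subset_line_of_isPreconnected hw hh hC hCP
  -- each side line is closed, so the closed arc (in the closure of `C`) lies on the same line
  have cre : ∀ a : ℝ, IsClosed {z : ℂ | z.re = a} := fun a => isClosed_eq continuous_re continuous_const
  have cim : ∀ a : ℝ, IsClosed {z : ℂ | z.im = a} := fun a => isClosed_eq continuous_im continuous_const
  rcases key with h1 | h1 | h1 | h1
  · exact Or.inl (hcl.trans ((cre 0).closure_subset_iff.2 h1))
  · exact Or.inr (Or.inl (hcl.trans ((cim 0).closure_subset_iff.2 h1)))
  · exact Or.inr (Or.inr (Or.inl (hcl.trans ((cre w).closure_subset_iff.2 h1))))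
  · exact Or.inr (Or.inr (Or.inr (hcl.trans ((cim h).closure_subset_iff.2 h1))))

/-- Points of an arc of the box lie on the perimeter: real part in `[0,w]`, imaginary part in
`[0,h]`. [folklore] -/
theorem re_im_mem_of_mem_arc (R : ConformalRectangle) (hw : 0 < w) (hh : 0 < h)
    (hcar : R.carrier = Ioo (0 : ℝ) w ×ℂ Ioo (0 : ℝ) h) {j : Fin 4} {z : ℂ} (hz : z ∈ R.arc j) :
    (0 ≤ z.re ∧ z.re ≤ w) ∧ (0 ≤ z.im ∧ z.im ≤ h) := by
  have hzP : z ∈ frontier (Ioo (0 : ℝ) w ×ℂ Ioo (0 : ℝ) h) := hcar ▸ R.arc_subset_frontier j hz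
  rcases (RectBox.mem_frontier_obox hw hh).1 hzP with ⟨⟨hr0, hrw⟩, him | him⟩ | ⟨hre | hre, hi0, hih⟩
  · exact ⟨⟨hr0, hrw⟩, by rw [him]; exact ⟨le_rfl, hh.le⟩⟩
  · exact ⟨⟨hr0, hrw⟩, by rw [him]; exact ⟨hh.le, le_rfl⟩⟩
  · exact ⟨by rw [hre]; exact ⟨le_rfl, hw.le⟩, hi0, hih⟩
  · exact ⟨by rw [hre]; exact ⟨hw.le, le_rfl⟩, hi0, hih⟩

end RectSides

open RectSides in
/-- **The side arcs of the corner-marked rectangle** (the statement of the sibling line's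
`RectValue … stub_sideArcs`, proved): for a conformal rectangle with carrier `(0,w)×(0,h)` and marks
`pt 0 = ih`, `pt 1 = 0`, `pt 2 = w`, `pt 3 = w + ih` (any boundary parametrisation), the arc
`(pt 0, pt 1)` is the closed left side and the arc `(pt 2, pt 3)` the closed right side. [folklore] -/
theorem rect_sideArcs : ∀ (R : Literature.Probability.RandomPlanarGeometry.ConformalRectangle) (w h : ℝ),
    0 < w → 0 < h → R.carrier = Set.Ioo (0:ℝ) w ×ℂ Set.Ioo (0:ℝ) h →
    (R.pt 0 = (h:ℂ) * Complex.I ∧ R.pt 1 = 0 ∧ R.pt 2 = (w:ℂ) ∧ R.pt 3 = (w:ℂ) + (h:ℂ) * Complex.I) →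
    R.arc 0 = {z : ℂ | z.re = 0 ∧ 0 ≤ z.im ∧ z.im ≤ h} ∧
      R.arc 2 = {z : ℂ | z.re = w ∧ 0 ≤ z.im ∧ z.im ≤ h} := by
  intro R w h hw hh hcar hpt
  -- the end points of the two arcs
  have h00 : (h : ℂ) * I ∈ R.arc 0 := hpt.1 ▸ R.pt_mem_arc_self 0
  have h01 : (0 : ℂ) ∈ R.arc 0 := by
    have := R.pt_succ_mem_arc 0
    rwa [show (0 : Fin 4) + 1 = 1 from rfl, hpt.2.1] at this
  have h22 : (w : ℂ) ∈ R.arc 2 := hpt.2.2.1 ▸ R.pt_mem_arc_self 2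
  have h23 : (w : ℂ) + (h : ℂ) * I ∈ R.arc 2 := by
    have := R.pt_succ_mem_arc 2
    rwa [show (2 : Fin 4) + 1 = 3 from rfl, hpt.2.2.2] at this
  have hconn : ∀ j : Fin 4, IsPreconnected (R.arc j) := fun j =>
    isPreconnected_Icc.image _ R.continuous_boundary.continuousOn
  constructor
  · -- arc 0 lies on the line `re = 0` (the other three lines miss an end point)
    have hline : R.arc 0 ⊆ {z : ℂ | z.re = 0} := by
      rcases arc_subset_line R hw hh hcar hpt (j := 0) (by decide) with h1 | h1 | h1 | h1
      · exact h1
      · exact absurd (h1 h00) (by simp [hh.ne'])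
      · exact absurd (h1 h01) (by simp [hw.ne])
      · exact absurd (h1 h01) (by simp [hh.ne])
    refine Subset.antisymm (fun z hz => ⟨hline hz, (re_im_mem_of_mem_arc R hw hh hcar hz).2⟩) ?_
    exact vsegment_subset_of_isPreconnected (hconn 0) hline h01 h00 (by simp) (by simp)
  · -- arc 2 lies on the line `re = w`
    have hline : R.arc 2 ⊆ {z : ℂ | z.re = w} := by
      rcases arc_subset_line R hw hh hcar hpt (j := 2) (by decide) with h1 | h1 | h1 | h1
      · exact absurd (h1 h22) (by simp [hw.ne'])
      · exact absurd (h1 h23) (by simp [hh.ne'])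
      · exact h1
      · exact absurd (h1 h22) (by simp [hh.ne])
    refine Subset.antisymm (fun z hz => ⟨hline hz, (re_im_mem_of_mem_arc R hw hh hcar hz).2⟩) ?_
    exact vsegment_subset_of_isPreconnected (hconn 2) hline h22 h23 (by simp) (by simp)

end Summit.CriticalPhenomena.CardyFormulaZ2.Cruxes.BoxFamilyToCardy.Birth

end
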